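import Summits.CriticalPhenomena.SAWScalingLimit.Theorems.SAWDefectDecoherenceObservableToSLERCarvedReductionSqueezeOneSided
import HarnessLib

/-!
# The uniformizer of the limit bulk on the closed disc: image, one-sided arcs, continuous
# inverse, and the two one-sidedness criteria (piece (K4b) of stub 5a4″ `stub_carvedReduction_squeezeSolid`)

Piece of stub 5a4″ `stub_carvedReduction_squeezeSolid`
(`TwoPieceAdmRestrictionLimit → MovingCarvingSqueezeP FatAnchoredClassZeroSolid`) of the line
`bridge-gate-renewal` (r11) of the crux `SAWDefectDecoherence.ObservableToSLER`
(stmt-CriticalPhenomena-14005; twin T-A `stub_carvedReduction_squeezeGeometry` of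
stmt-CriticalPhenomena-10472), contract `InnerApproximant` (twin memo items 5–7).  The inner
approximant is `M' = ψ̄ (U)` for a uniformizer `ψ : 𝔻 → Ω*` of the limit bulk whose extension
`ψ̄ = extendFrom 𝔻 ψ` is continuous on the closed disc (`…SqueezeBoundaryLC` + Literature
`CaratheodoryLC`); `Ω*` has pinch points, so `ψ̄` is NOT injective on the circle, but it is at the
ONE-SIDED boundary points `w` (`Ω*ᶜ ∖ {w}` connected; `…SqueezeOneSided`).  This file packages what
the construction uses about `ψ̄`:

* `image_extendFrom_closedBall'`, `image_extendFrom_sphere'` — `ψ̄ (𝔻̄) = closure Ω*`,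
  `ψ̄ (∂𝔻) = ∂Ω*` for any bounded open `Ω*`;
* `injOn_extendFrom_ball_union` — `ψ̄` is injective on `𝔻 ∪ S` for any set `S` of circle points
  with one-sided images (the hypothesis of `stub_carvedReduction_starImage`);
* `continuousOn_invFunOn_sphere` — the inverse boundary correspondence `w ↦ ψ̄⁻¹ w` is continuous
  on any set of boundary values with a unique circle preimage (far points of `∂(D - τ)`);
* `stub_carvedReduction_oneSidedCriteria` — the two criteria feeding it: a point of an open flat
  WINDOW segment (`Ω*` is the upper half-disc near it) and a FAR point of the Jordan curve
  `∂(D - τ)` presented by a Schoenflies homeomorphism `H` (`Ω*` agrees with `H(𝔻)` near it) are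
  one-sided, by `isPreconnected_diff_singleton_of_local` with a half-disc, resp. the `H`-image of
  the annulus `{1 ≤ |z| < 2}` minus a point.

Sources: Ch. Pommerenke, Boundary Behaviour of Conformal Maps (1992), Thms. 2.1, 2.6.
-/

noncomputable section
open Set Filter Metric Topology Complex Real Function
open Literature.Probability.RandomPlanarGeometry

namespace Summit.CriticalPhenomena.SAWScalingLimit.Theorems.ObservableToSLER.Squeeze

section Extension

variable {G : Set ℂ} (ψ : ConformalEquiv (ball (0 : ℂ) 1) G)

/-- `ψ̄ (𝔻̄) = closure Ω*` for a conformal equivalence `ψ : 𝔻 → Ω*` onto a bounded open set whose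
extension is continuous on the closed disc and is the limit of `ψ` at every point. -/
theorem image_extendFrom_closedBall'
    (hΦc : ContinuousOn (extendFrom (ball 0 1) ψ) (closedBall (0 : ℂ) 1))
    (htend : ∀ x ∈ closedBall (0 : ℂ) 1,
      Tendsto ψ (𝓝[ball 0 1] x) (𝓝 (extendFrom (ball 0 1) ψ x))) :
    extendFrom (ball 0 1) ψ '' closedBall 0 1 = closure G := by
  have hext : ∀ x ∈ ball (0 : ℂ) 1, extendFrom (ball 0 1) ψ x = ψ x :=
    fun x hx => extendFrom_extends ψ.continuousOn x hx
  refine Subset.antisymm ?_ ?_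
  · rintro _ ⟨x, hx, rfl⟩
    have hxcl : x ∈ closure (ball (0 : ℂ) 1) := by rwa [closure_ball 0 one_ne_zero]
    haveI : (𝓝[ball (0 : ℂ) 1] x).NeBot := mem_closure_iff_nhdsWithin_neBot.1 hxcl
    exact mem_closure_of_tendsto (htend x hx)
      (eventually_mem_nhdsWithin.mono fun z hz ↦ ψ.mapsTo hz)
  · have hcpt : IsCompact (extendFrom (ball 0 1) ψ '' closedBall 0 1) :=
      (isCompact_closedBall 0 1).image_of_continuousOn hΦc
    refine closure_minimal ?_ hcpt.isClosed
    intro w hw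
    refine ⟨ψ.symm w, ball_subset_closedBall (ψ.symm_mapsTo hw), ?_⟩
    rw [hext _ (ψ.symm_mapsTo hw), ψ.apply_symm_apply hw]

/-- `ψ̄ (∂𝔻) = ∂Ω*` under the same hypotheses (`Ω*` open). -/
theorem image_extendFrom_sphere' (hG : IsOpen G)
    (hΦc : ContinuousOn (extendFrom (ball 0 1) ψ) (closedBall (0 : ℂ) 1))
    (htend : ∀ x ∈ closedBall (0 : ℂ) 1,
      Tendsto ψ (𝓝[ball 0 1] x) (𝓝 (extendFrom (ball 0 1) ψ x))) :
    extendFrom (ball 0 1) ψ '' sphere 0 1 = frontier G := by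
  have hext : ∀ x ∈ ball (0 : ℂ) 1, extendFrom (ball 0 1) ψ x = ψ x :=
    fun x hx => extendFrom_extends ψ.continuousOn x hx
  refine Subset.antisymm ?_ ?_
  · rintro _ ⟨x, hx, rfl⟩
    exact extendFrom_mem_frontier' ψ hG (mem_sphere_zero_iff_norm.1 hx)
      (htend x (sphere_subset_closedBall hx))
  · intro w hw
    rw [hG.frontier_eq, ← image_extendFrom_closedBall' ψ hΦc htend] at hw
    obtain ⟨⟨x, hx, rfl⟩, hwG⟩ := hw
    have hx1 : ‖x‖ = 1 := by
      refine le_antisymm (mem_closedBall_zero_iff.1 hx) (not_lt.1 fun hlt => hwG ?_)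
      rw [hext x (mem_ball_zero_iff.2 hlt)]
      exact ψ.mapsTo (mem_ball_zero_iff.2 hlt)
    exact ⟨x, mem_sphere_zero_iff_norm.2 hx1, rfl⟩

/-- **Injectivity on the disc plus a one-sided arc.**  If every point of `S ⊆ ∂𝔻` has a one-sided
image (`Ω*ᶜ ∖ {ψ̄ x}` connected), then `ψ̄` is injective on `𝔻 ∪ S`. [cite: PommerenkeBBCM1992, Thm. 2.6 (injectivity step)] -/
theorem injOn_extendFrom_ball_union (hG : IsOpen G) (hGb : Bornology.IsBounded G)
    (hΦc : ContinuousOn (extendFrom (ball 0 1) ψ) (closedBall (0 : ℂ) 1))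
    (htend : ∀ x ∈ closedBall (0 : ℂ) 1,
      Tendsto ψ (𝓝[ball 0 1] x) (𝓝 (extendFrom (ball 0 1) ψ x)))
    {S : Set ℂ} (hS : S ⊆ sphere 0 1)
    (hcut : ∀ x ∈ S, IsConnected (Gᶜ \ {extendFrom (ball 0 1) ψ x})) :
    InjOn (extendFrom (ball 0 1) ψ) (ball 0 1 ∪ S) := by
  have hext : ∀ x ∈ ball (0 : ℂ) 1, extendFrom (ball 0 1) ψ x = ψ x :=
    fun x hx => extendFrom_extends ψ.continuousOn x hx
  -- a circle point of `S` and a disc point never share their image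
  have hmix : ∀ x ∈ ball (0 : ℂ) 1, ∀ y ∈ S,
      extendFrom (ball 0 1) ψ x ≠ extendFrom (ball 0 1) ψ y := by
    intro x hx y hy hxy
    have hyfr := extendFrom_mem_frontier' ψ hG (mem_sphere_zero_iff_norm.1 (hS hy))
      (htend y (sphere_subset_closedBall (hS hy)))
    rw [hG.frontier_eq] at hyfr
    exact hyfr.2 (hxy ▸ (hext x hx).symm ▸ ψ.mapsTo hx)
  rintro x (hx | hx) y (hy | hy) hxy
  · rw [hext x hx, hext y hy] at hxy
    exact ψ.injOn hx hy hxy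
  · exact absurd hxy (hmix x hx y hy)
  · exact absurd hxy.symm (hmix y hy x hx)
  · exact eq_of_extendFrom_eq_of_nonCut ψ hG hGb hΦc htend (mem_sphere_zero_iff_norm.1 (hS hx))
      (mem_sphere_zero_iff_norm.1 (hS hy)) hxy (hcut x hx)

/-- **Continuity of the inverse boundary correspondence at values with one preimage.**  Let
`Φ` be continuous on the unit circle and `T` a set of values each of which has exactly one
preimage on the circle.  Then `invFunOn Φ (sphere 0 1)` is continuous on `T` (closed subsets of
the circle have compact images). -/
theorem continuousOn_invFunOn_sphere {Φ : ℂ → ℂ} (hΦc : ContinuousOn Φ (sphere (0 : ℂ) 1))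
    {T : Set ℂ} (hT : T ⊆ Φ '' sphere 0 1)
    (huniq : ∀ w ∈ T, (sphere (0 : ℂ) 1 ∩ Φ ⁻¹' {w}).Subsingleton) :
    ContinuousOn (invFunOn Φ (sphere (0 : ℂ) 1)) T := by
  set g := invFunOn Φ (sphere (0 : ℂ) 1) with hg
  have hgmem : ∀ w ∈ T, g w ∈ sphere (0 : ℂ) 1 ∧ Φ (g w) = w := fun w hw => by
    obtain ⟨x, hx, rfl⟩ := hT hw
    exact ⟨invFunOn_mem ⟨x, hx, rfl⟩, invFunOn_eq ⟨x, hx, rfl⟩⟩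
  rw [continuousOn_iff_isClosed]
  intro C hC
  refine ⟨Φ '' (C ∩ sphere 0 1), (((isCompact_sphere 0 1).of_isClosed_subset
    (hC.inter isClosed_sphere) inter_subset_right).image_of_continuousOn
      (hΦc.mono inter_subset_right)).isClosed, ?_⟩
  ext w
  constructor
  · rintro ⟨hwC, hwT⟩
    exact ⟨⟨g w, ⟨hwC, (hgmem w hwT).1⟩, (hgmem w hwT).2⟩, hwT⟩
  · rintro ⟨⟨c, ⟨hcC, hcS⟩, hcw⟩, hwT⟩
    refine ⟨?_, hwT⟩
    have : g w = c := huniq w hwT ⟨(hgmem w hwT).1, (hgmem w hwT).2⟩ ⟨hcS, hcw⟩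
    show g w ∈ C
    rwa [this]

end Extension

/-! ### One-sidedness at a flat window -/

/-- A closed lower half-disc minus the midpoint of its diameter is preconnected: it is the union of
the open lower part and the two halves off the vertical axis, three convex pieces pairwise linked. -/
theorem isPreconnected_lowerHalfDisc_diff {w : ℂ} {ε : ℝ} (hε : 0 < ε) :
    IsPreconnected ((closedBall w ε ∩ {z : ℂ | z.im ≤ w.im}) \ {w}) := by
  set V : Set ℂ := closedBall w ε ∩ {z : ℂ | z.im ≤ w.im} with hV
  have hVconv : Convex ℝ V := (convex_closedBall w ε).inter (convex_halfSpace_im_le w.im)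
  set A : Set ℂ := V ∩ {z : ℂ | z.im < w.im} with hA
  set L : Set ℂ := V ∩ {z : ℂ | z.re < w.re} with hL
  set R : Set ℂ := V ∩ {z : ℂ | w.re < z.re} with hR
  have hAc : IsPreconnected A := (hVconv.inter (convex_halfSpace_im_lt _)).isPreconnected
  have hLc : IsPreconnected L := (hVconv.inter (convex_halfSpace_re_lt _)).isPreconnected
  have hRc : IsPreconnected R := (hVconv.inter (convex_halfSpace_re_gt _)).isPreconnected
  have hcover : V \ {w} = A ∪ L ∪ R := by
    ext z
    simp only [Set.mem_sdiff, mem_singleton_iff, mem_union, hA, hL, hR, mem_inter_iff, mem_setOf_eq]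
    constructor
    · rintro ⟨hzV, hzw⟩
      have hzim : z.im ≤ w.im := hzV.2
      rcases hzim.lt_or_eq with hlt | heq
      · exact Or.inl (Or.inl ⟨hzV, hlt⟩)
      · have hre : z.re ≠ w.re := fun h => hzw (Complex.ext h heq)
        rcases hre.lt_or_gt with h | h
        · exact Or.inl (Or.inr ⟨hzV, h⟩)
        · exact Or.inr ⟨hzV, h⟩
    · rintro ((⟨hzV, h⟩ | ⟨hzV, h⟩) | ⟨hzV, h⟩)
      · exact ⟨hzV, fun hzw => by rw [hzw] at h; exact lt_irrefl _ h⟩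
      · exact ⟨hzV, fun hzw => by rw [hzw] at h; exact lt_irrefl _ h⟩
      · exact ⟨hzV, fun hzw => by rw [hzw] at h; exact lt_irrefl _ h⟩
  -- the two linking points `w - ε/2 (1 + i)/… `
  have hnorm : ‖((ε / 4 : ℝ) : ℂ) + ((ε / 4 : ℝ) : ℂ) * I‖ ≤ ε := by
    have h1 : ‖((ε / 4 : ℝ) : ℂ) + ((ε / 4 : ℝ) : ℂ) * I‖ ≤ ‖((ε / 4 : ℝ) : ℂ)‖ +
        ‖((ε / 4 : ℝ) : ℂ) * I‖ := norm_add_le _ _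
    rw [norm_mul, Complex.norm_I, mul_one, Complex.norm_real, Real.norm_eq_abs,
      abs_of_pos (by positivity)] at h1
    linarith
  have hpL : w - (((ε / 4 : ℝ) : ℂ) + ((ε / 4 : ℝ) : ℂ) * I) ∈ A ∩ L := by
    refine ⟨⟨⟨?_, ?_⟩, ?_⟩, ⟨?_, ?_⟩, ?_⟩
    · rw [mem_closedBall, dist_eq_norm, sub_sub_cancel_left, norm_neg]; exact hnorm
    · simp; positivity
    · simp; positivity
    · rw [mem_closedBall, dist_eq_norm, sub_sub_cancel_left, norm_neg]; exact hnorm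
    · simp; positivity
    · simp; positivity
  have hpR : w - (-((ε / 4 : ℝ) : ℂ) + ((ε / 4 : ℝ) : ℂ) * I) ∈ A ∩ R := by
    have hnorm' : ‖-((ε / 4 : ℝ) : ℂ) + ((ε / 4 : ℝ) : ℂ) * I‖ ≤ ε := by
      have h1 : ‖-((ε / 4 : ℝ) : ℂ) + ((ε / 4 : ℝ) : ℂ) * I‖ ≤ ‖-((ε / 4 : ℝ) : ℂ)‖ +
          ‖((ε / 4 : ℝ) : ℂ) * I‖ := norm_add_le _ _
      rw [norm_neg, norm_mul, Complex.norm_I, mul_one, Complex.norm_real, Real.norm_eq_abs,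
        abs_of_pos (by positivity)] at h1
      linarith
    refine ⟨⟨⟨?_, ?_⟩, ?_⟩, ⟨?_, ?_⟩, ?_⟩
    · rw [mem_closedBall, dist_eq_norm, sub_sub_cancel_left, norm_neg]; exact hnorm'
    · simp; positivity
    · simp; positivity
    · rw [mem_closedBall, dist_eq_norm, sub_sub_cancel_left, norm_neg]; exact hnorm'
    · simp; positivity
    · simp; positivity
  rw [hcover]
  exact (hAc.union' ⟨_, hpL⟩ hLc).union' ⟨_, Or.inl hpR.1, hpR.2⟩ hRc

/-- **One-sidedness at a flat window.**  If `Ω*ᶜ` is preconnected, the open upper half of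
`ball g ρ` lies in `Ω*` and its closed lower half in `Ω*ᶜ`, then every point `w` of the open
diameter (`im w = im g`, `dist w g < ρ`) is one-sided: `Ω*ᶜ ∖ {w}` is connected. -/
theorem isConnected_compl_diff_of_window {Ω : Set ℂ} (hΩc : IsPreconnected Ωᶜ) {g : ℂ} {ρ : ℝ}
    (hup : {z : ℂ | g.im < z.im} ∩ ball g ρ ⊆ Ω) (hlow : {z : ℂ | z.im ≤ g.im} ∩ ball g ρ ⊆ Ωᶜ)
    {w : ℂ} (hw : w.im = g.im) (hwg : dist w g < ρ) (hne : (Ωᶜ \ {w}).Nonempty) :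
    IsConnected (Ωᶜ \ {w}) := by
  set ε : ℝ := (ρ - dist w g) / 2 with hε
  have hεpos : 0 < ε := by rw [hε]; linarith
  have hball : closedBall w ε ⊆ ball g ρ := fun z hz =>
    mem_ball.2 (by linarith [dist_triangle z w g, mem_closedBall.1 hz])
  set V : Set ℂ := closedBall w ε ∩ {z : ℂ | z.im ≤ w.im} with hV
  have hVsub : V ⊆ Ωᶜ := fun z hz => hlow ⟨by rw [← hw]; exact hz.2, hball hz.1⟩
  have hwV : w ∈ V := ⟨mem_closedBall_self hεpos.le, (le_refl _ : w.im ≤ w.im)⟩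
  have hVn : V ∈ 𝓝[Ωᶜ] w := by
    refine mem_nhdsWithin.2 ⟨ball w ε, isOpen_ball, mem_ball_self hεpos, fun z hz => ⟨?_, ?_⟩⟩
    · exact ball_subset_closedBall hz.1
    · show z.im ≤ w.im
      by_contra hlt
      push Not at hlt
      exact hz.2 (hup ⟨by rw [← hw]; exact hlt, hball (ball_subset_closedBall hz.1)⟩)
  exact ⟨hne, isPreconnected_diff_singleton_of_local hΩc hVsub hwV hVn
    (isPreconnected_lowerHalfDisc_diff hεpos)⟩

/-! ### One-sidedness at a far point of the Jordan curve -/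

/-- The half-open annulus `{1 ≤ ‖z‖ < 2}` minus a point of the unit circle is preconnected: it
lies between the open annulus `{1 < ‖z‖ < 2} = exp {0 < re < log 2}` and its closure. -/
theorem isPreconnected_annulus_diff {ζ : ℂ} (hζ : ‖ζ‖ = 1) :
    IsPreconnected ({z : ℂ | 1 ≤ ‖z‖ ∧ ‖z‖ < 2} \ {ζ}) := by
  set W₁ : Set ℂ := {z : ℂ | 1 < ‖z‖ ∧ ‖z‖ < 2} with hW₁
  have hW₁c : IsPreconnected W₁ := by
    have heq : W₁ = Complex.exp '' {χ : ℂ | 0 < χ.re ∧ χ.re < Real.log 2} := by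
      ext z
      constructor
      · rintro ⟨hz1, hz2⟩
        refine ⟨Complex.log z, ⟨?_, ?_⟩, Complex.exp_log (norm_pos_iff.1 (by linarith))⟩
        · simp only [Complex.log_re]; exact Real.log_pos hz1
        · simp only [Complex.log_re]; exact Real.log_lt_log (by linarith) hz2
      · rintro ⟨χ, ⟨h1, h2⟩, rfl⟩
        refine ⟨by rw [Complex.norm_exp]; exact Real.one_lt_exp_iff.2 h1, ?_⟩
        rw [Complex.norm_exp]
        calc Real.exp χ.re < Real.exp (Real.log 2) := Real.exp_lt_exp.2 h2
          _ = 2 := Real.exp_log (by norm_num)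
    rw [heq]
    exact ((convex_halfSpace_re_gt 0).inter (convex_halfSpace_re_lt _)).isPreconnected.image _
      Complex.continuous_exp.continuousOn
  refine hW₁c.subset_closure ?_ ?_
  · rintro z ⟨hz1, hz2⟩
    refine ⟨⟨hz1.le, hz2⟩, fun hzζ => ?_⟩
    rw [mem_singleton_iff] at hzζ
    rw [hzζ, hζ] at hz1
    exact lt_irrefl _ hz1
  · rintro z ⟨⟨hz1, hz2⟩, -⟩
    rw [Metric.mem_closure_iff]
    intro δ hδ
    set t : ℝ := min (δ / 2) ((2 - ‖z‖) / 2) with ht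
    have htpos : 0 < t := lt_min (by linarith) (by linarith)
    have hz0 : 0 < ‖z‖ := by linarith
    refine ⟨(((1 : ℝ) + t / ‖z‖ : ℝ) : ℂ) * z, ⟨?_, ?_⟩, ?_⟩
    · rw [norm_mul, Complex.norm_real, Real.norm_eq_abs, abs_of_pos (by positivity), add_mul,
        one_mul, div_mul_cancel₀ _ hz0.ne']
      linarith
    · rw [norm_mul, Complex.norm_real, Real.norm_eq_abs, abs_of_pos (by positivity), add_mul,
        one_mul, div_mul_cancel₀ _ hz0.ne']
      have : t ≤ (2 - ‖z‖) / 2 := min_le_right _ _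
      linarith
    · rw [dist_eq_norm, show z - (((1 : ℝ) + t / ‖z‖ : ℝ) : ℂ) * z = -(((t / ‖z‖ : ℝ) : ℂ) * z) by
        push_cast; ring, norm_neg, norm_mul, Complex.norm_real, Real.norm_eq_abs,
        abs_of_pos (by positivity), div_mul_cancel₀ _ hz0.ne']
      have : t ≤ δ / 2 := min_le_left _ _
      linarith

/-- **One-sidedness at a far boundary point.**  Let `H` be a homeomorphism of `ℂ` and
`Ω* ⊆ H(𝔻)` with `Ω*ᶜ` preconnected; let `w = H ζ`, `‖ζ‖ = 1`, be a point near which `Ω*` agrees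
with `H(𝔻)` (`O ∩ H(𝔻) ⊆ Ω*` for an open `O ∋ w`).  Then `Ω*ᶜ ∖ {w}` is connected. -/
theorem isConnected_compl_diff_of_far {Ω : Set ℂ} (hΩc : IsPreconnected Ωᶜ) (H : ℂ ≃ₜ ℂ)
    (hΩH : Ω ⊆ H '' ball 0 1) {ζ : ℂ} (hζ : ‖ζ‖ = 1) {O : Set ℂ} (hO : IsOpen O) (hwO : H ζ ∈ O)
    (hloc : O ∩ H '' ball 0 1 ⊆ Ω) : IsConnected (Ωᶜ \ {H ζ}) := by
  -- `V = H {1 ≤ |z| < 2}` is a neighbourhood of `w` in `Ω*ᶜ` with `V ∖ {w}` preconnected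
  set Ann : Set ℂ := {z : ℂ | 1 ≤ ‖z‖ ∧ ‖z‖ < 2} with hAnn
  set V : Set ℂ := H '' Ann with hV
  have hout : ∀ z : ℂ, 1 ≤ ‖z‖ → H z ∈ Ωᶜ := fun z hz hzΩ => by
    obtain ⟨y, hy, hyz⟩ := hΩH hzΩ
    rw [H.injective hyz, mem_ball_zero_iff] at hy
    exact not_lt.2 hz hy
  have hVsub : V ⊆ Ωᶜ := by
    rintro _ ⟨z, hz, rfl⟩
    exact hout z hz.1
  have hwV : H ζ ∈ V := ⟨ζ, ⟨hζ.ge, by rw [hζ]; norm_num⟩, rfl⟩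
  -- an `H`-ball about `ζ` inside `O`
  obtain ⟨s, hs, hsO⟩ : ∃ s > (0 : ℝ), H '' ball ζ s ⊆ O := by
    have : H ⁻¹' O ∈ 𝓝 ζ := H.continuous.continuousAt.preimage_mem_nhds (hO.mem_nhds hwO)
    obtain ⟨s, hs, hsub⟩ := Metric.mem_nhds_iff.1 this
    exact ⟨s, hs, image_subset_iff.2 hsub⟩
  have hVn : V ∈ 𝓝[Ωᶜ] (H ζ) := by
    refine mem_nhdsWithin.2 ⟨H '' ball ζ (min s 1), H.isOpenMap _ isOpen_ball,
      ⟨ζ, mem_ball_self (lt_min hs one_pos), rfl⟩, ?_⟩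
    rintro _ ⟨⟨z, hz, rfl⟩, hzΩ⟩
    have hz' : dist z ζ < min s 1 := mem_ball.1 hz
    refine ⟨z, ⟨?_, ?_⟩, rfl⟩
    · by_contra hlt
      push Not at hlt
      exact hzΩ (hloc ⟨hsO ⟨z, mem_ball.2 (hz'.trans_le (min_le_left _ _)), rfl⟩,
        ⟨z, mem_ball_zero_iff.2 hlt, rfl⟩⟩)
    · have hzn : ‖z - ζ‖ < 1 := by
        rw [← dist_eq_norm]; exact hz'.trans_le (min_le_right _ _)
      calc ‖z‖ = ‖(z - ζ) + ζ‖ := by rw [sub_add_cancel]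
        _ ≤ ‖z - ζ‖ + ‖ζ‖ := norm_add_le _ _
        _ < 2 := by rw [hζ]; linarith
  have hVw : V \ {H ζ} = H '' (Ann \ {ζ}) := by
    rw [hV, image_sdiff H.injective, image_singleton]
  have hne : (Ωᶜ \ {H ζ}).Nonempty := by
    refine ⟨H (((3 : ℝ) / 2 : ℝ) : ℂ), hout _ ?_, fun h => ?_⟩
    · rw [Complex.norm_real]; norm_num
    · have := H.injective (mem_singleton_iff.1 h)
      have h2 := congrArg (fun z : ℂ => ‖z‖) this
      simp only [Complex.norm_real, hζ] at h2
      norm_num at h2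
  refine ⟨hne, isPreconnected_diff_singleton_of_local hΩc hVsub hwV hVn ?_⟩
  rw [hVw]
  exact (isPreconnected_annulus_diff hζ).image _ H.continuous.continuousOn

/-- **Registered sub-goal `stub_carvedReduction_oneSidedCriteria`** (crux item stmt-CriticalPhenomena-14005,
stub 5a4″ `stub_carvedReduction_squeezeSolid`, piece (K4b) ONE-SIDEDNESS CRITERIA): for a set `Ω`
with preconnected complement, (i) every point of an open flat window segment (open upper
half-disc inside `Ω`, closed lower half-disc outside) and (ii) every far boundary point `H ζ` of a
Schoenflies presentation `Ω ⊆ H(𝔻)` near which `Ω` agrees with `H(𝔻)`, is one-sided: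
`Ωᶜ ∖ {w}` is connected. [cite: PommerenkeBBCM1992, Thm. 2.6] -/
theorem stub_carvedReduction_oneSidedCriteria :
    ∀ (Ω : Set ℂ), IsPreconnected Ωᶜ →
      (∀ (g : ℂ) (ρ : ℝ) (w : ℂ), {z : ℂ | g.im < z.im} ∩ ball g ρ ⊆ Ω →
        {z : ℂ | z.im ≤ g.im} ∩ ball g ρ ⊆ Ωᶜ → w.im = g.im → dist w g < ρ →
        (Ωᶜ \ {w}).Nonempty → IsConnected (Ωᶜ \ {w})) ∧
      (∀ (H : ℂ ≃ₜ ℂ) (ζ : ℂ) (O : Set ℂ), Ω ⊆ H '' ball 0 1 → ‖ζ‖ = 1 → IsOpen O → H ζ ∈ O →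
        O ∩ H '' ball 0 1 ⊆ Ω → IsConnected (Ωᶜ \ {H ζ})) := by
  intro Ω hΩc
  exact ⟨fun g ρ w hup hlow hw hwg hne => isConnected_compl_diff_of_window hΩc hup hlow hw hwg hne,
    fun H ζ O hΩH hζ hO hwO hloc => isConnected_compl_diff_of_far hΩc H hΩH hζ hO hwO hloc⟩

end Summit.CriticalPhenomena.SAWScalingLimit.Theorems.ObservableToSLER.Squeeze

end
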